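import Summits.HubbardSuperconductivity.HubbardSuperconductivity.Theorems.WeakCouplingBCSKlLindhardEnclosureHyperbolaABCore

/-!
# KL-MARGIN-SCAN reader (22) «kernel-lindhard-enclosure» — the 2-D majorised-hyperbola variant `vAB` ON THE KERNEL DATA

Instantiation of `…HyperbolaABCore.hyperbolaAB_core` for both straddler positions: generalized dominations `dom_sh_gen` / `dom_nsh_gen`
(the abscissa-cosine range `[lo, hi]/2^40` of the piece is an input), and `vAB_sh_valid` / `vAB_nsh_valid`: under the kernel's checks
(`piecesOK` on the straddler's two cosine ranges, both lower sine hints checked and positive, `0 < Vlo`) the value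
`cdivZ (2^30·10⁸·Σ_{m<8} bdryPieceUp (!far) Vlo α_m α_{m+1} βLo βUp) (τx·τy·D)` is a certified ceiling of the cell.  Honest framing: nothing
in this file asserts a KL margin at any `t′ ≠ 0`, `K₃`, `U₀`, the window or B1g dominance; a Kohn–Luttinger instability statement is not ODLRO
and nothing here proves superconductivity in the Hubbard model.  (p1 g26, 2026-08-29.)
-/

noncomputable section

set_option linter.dupNamespace false

namespace Summit.HubbardSuperconductivity.HubbardSuperconductivity.Theorems.KlLindhardEnclosure

open Real Set MeasureTheory Literature.MathematicalPhysics.QuantumLattice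
open Summit.HubbardSuperconductivity.HubbardSuperconductivity.Theorems

/-! ## §1 Generalized dominations (piece range as input) -/

/-- Generalized domination (straddler `p + q`): the abscissa-cosine range `[lo, hi]/2^40` is an input. -/
theorem Params.dom_sh_gen (P : Params) (hP : P.admissible = true) {a b c d : ℤ} (hin : P.InRoot a b c d) (far : Bool)
    (hg : (P.cell (P.mkX a) (P.mkX b) (P.mkY c) (P.mkY d)).guards = true) (hs1 : P.status (P.cell (P.mkX a) (P.mkX b) (P.mkY c) (P.mkY d)).e1Lo (P.cell (P.mkX a) (P.mkX b) (P.mkY c) (P.mkY d)).e1Hi = some far) {lo hi : ℤ} (hslo : 0 < P.sDnZ lo) (hshi : 0 < P.sDnZ hi) (hV : 0 < P.distLoZ (P.cell (P.mkX a) (P.mkX b) (P.mkY c) (P.mkY d)).e1Lo (P.cell (P.mkX a) (P.mkX b) (P.mkY c) (P.mkY d)).e1Hi)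
    {x y : ℝ} (hx : x ∈ Icc ((a : ℝ) / (P.U : ℝ)) ((b : ℝ) / (P.U : ℝ))) (hy : y ∈ Icc ((c : ℝ) / (P.U : ℝ)) ((d : ℝ) / (P.U : ℝ)))
    (hax : ((lo : ℤ) : ℝ) / 2 ^ 40 ≤ Real.cos (x + (P.q1z : ℝ) / (P.U : ℝ)) ∧ Real.cos (x + (P.q1z : ℝ) / (P.U : ℝ)) ≤ ((hi : ℤ) : ℝ) / 2 ^ 40) :
    P.integrand (pt x y) ≤ cres (!far) (P.cresPos far ((((P.cell (P.mkX a) (P.mkX b) (P.mkY c) (P.mkY d)).bLo' : ℤ) : ℝ) / 2 ^ 40) ((((P.cell (P.mkX a) (P.mkX b) (P.mkY c) (P.mkY d)).bUp' : ℤ) : ℝ) / 2 ^ 40) (Real.cos (x + (P.q1z : ℝ) / (P.U : ℝ))))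
      (((min (P.sDnZ lo) (P.sDnZ hi) : ℤ) : ℝ) / 2 ^ 40) (((P.distLoZ (P.cell (P.mkX a) (P.mkX b) (P.mkY c) (P.mkY d)).e1Lo (P.cell (P.mkX a) (P.mkX b) (P.mkY c) (P.mkY d)).e1Hi : ℤ) : ℝ) / 2 ^ 40) (Real.cos (y + (P.q2z : ℝ) / (P.U : ℝ))) := by
  obtain ⟨htpD, hmuD, hU, -, -⟩ := P.admissible_facts hP
  obtain ⟨ha, -, -, hb, hc, -, -, hd⟩ := id hin
  obtain ⟨β1, β2⟩ := P.cell_cosy'_mem hP (a := a) (b := b) hc hd hy.1 hy.2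
  obtain ⟨hSmin, hSminle, hS⟩ := P.sMin_facts htpD hslo hshi hax.1 hax.2
  obtain ⟨e1l, e1h⟩ := P.cell_band_mem_Icc hP hin hg hx hy
  have hVef := P.distLoZ_le hmuD e1l e1h
  have hVpos : (0 : ℝ) < ((P.distLoZ (P.cell (P.mkX a) (P.mkX b) (P.mkY c) (P.mkY d)).e1Lo (P.cell (P.mkX a) (P.mkX b) (P.mkY c) (P.mkY d)).e1Hi : ℤ) : ℝ) / 2 ^ 40 := div_pos (by exact_mod_cast hV) (by positivity)
  have hfar : (P.band (pt x y) < (P.muN : ℝ) / (P.muD : ℝ)) ↔ far = true := by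
    rw [← P.cast_mu]
    cases far with
    | true => exact ⟨fun _ => rfl, fun _ => lt_of_le_of_lt e1h (P.status_true_lt hmuD hs1)⟩
    | false => exact ⟨fun h => absurd h (not_lt.mpr ((P.status_false_le hmuD hs1).trans e1l)), fun h => by simp at h⟩
  have key := P.dom_point far hS hSmin hSminle hVpos (by rw [← P.cast_mu]; exact hVef) hfar ⟨β1, β2⟩
  rw [P.integrand_eq_ite, P.band_pt_shift, P.cast_mu]
  exact key

/-- Generalized domination (straddler `p`): the abscissa-cosine range `[lo, hi]/2^40` is an input. -/
theorem Params.dom_nsh_gen (P : Params) (hP : P.admissible = true) {a b c d : ℤ} (hin : P.InRoot a b c d) (far : Bool)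
    (hg : (P.cell (P.mkX a) (P.mkX b) (P.mkY c) (P.mkY d)).guards = true) (hs2 : P.status (P.cell (P.mkX a) (P.mkX b) (P.mkY c) (P.mkY d)).e2Lo (P.cell (P.mkX a) (P.mkX b) (P.mkY c) (P.mkY d)).e2Hi = some far) {lo hi : ℤ} (hslo : 0 < P.sDnZ lo) (hshi : 0 < P.sDnZ hi) (hV : 0 < P.distLoZ (P.cell (P.mkX a) (P.mkX b) (P.mkY c) (P.mkY d)).e2Lo (P.cell (P.mkX a) (P.mkX b) (P.mkY c) (P.mkY d)).e2Hi)
    {x y : ℝ} (hx : x ∈ Icc ((a : ℝ) / (P.U : ℝ)) ((b : ℝ) / (P.U : ℝ))) (hy : y ∈ Icc ((c : ℝ) / (P.U : ℝ)) ((d : ℝ) / (P.U : ℝ)))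
    (hax : ((lo : ℤ) : ℝ) / 2 ^ 40 ≤ Real.cos x ∧ Real.cos x ≤ ((hi : ℤ) : ℝ) / 2 ^ 40) :
    P.integrand (pt x y) ≤ cres (!far) (P.cresPos far ((((P.cell (P.mkX a) (P.mkX b) (P.mkY c) (P.mkY d)).bLo : ℤ) : ℝ) / 2 ^ 40) ((((P.cell (P.mkX a) (P.mkX b) (P.mkY c) (P.mkY d)).bUp : ℤ) : ℝ) / 2 ^ 40) (Real.cos x))
      (((min (P.sDnZ lo) (P.sDnZ hi) : ℤ) : ℝ) / 2 ^ 40) (((P.distLoZ (P.cell (P.mkX a) (P.mkX b) (P.mkY c) (P.mkY d)).e2Lo (P.cell (P.mkX a) (P.mkX b) (P.mkY c) (P.mkY d)).e2Hi : ℤ) : ℝ) / 2 ^ 40) (Real.cos (y + 0)) := by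
  obtain ⟨htpD, hmuD, hU, -, -⟩ := P.admissible_facts hP
  obtain ⟨ha, -, -, hb, hc, -, -, hd⟩ := id hin
  obtain ⟨β1, β2⟩ := P.cell_cosy_mem hP (a := a) (b := b) hc hd hy.1 hy.2
  obtain ⟨hSmin, hSminle, hS⟩ := P.sMin_facts htpD hslo hshi hax.1 hax.2
  obtain ⟨e2l, e2h⟩ := P.cell_band_shift_mem_Icc hP hin hg hx hy
  have hVef := P.distLoZ_le hmuD e2l e2h
  have hVpos : (0 : ℝ) < ((P.distLoZ (P.cell (P.mkX a) (P.mkX b) (P.mkY c) (P.mkY d)).e2Lo (P.cell (P.mkX a) (P.mkX b) (P.mkY c) (P.mkY d)).e2Hi : ℤ) : ℝ) / 2 ^ 40 := div_pos (by exact_mod_cast hV) (by positivity)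
  have hfar : (P.band (pt x y + P.qv) < (P.muN : ℝ) / (P.muD : ℝ)) ↔ far = true := by
    rw [← P.cast_mu]
    cases far with
    | true => exact ⟨fun _ => rfl, fun _ => lt_of_le_of_lt e2h (P.status_true_lt hmuD hs2)⟩
    | false => exact ⟨fun h => absurd h (not_lt.mpr ((P.status_false_le hmuD hs2).trans e2l)), fun h => by simp at h⟩
  have key := P.dom_point far hS hSmin hSminle hVpos (by rw [← P.cast_mu]; exact hVef) hfar ⟨β1, β2⟩
  rw [add_zero, P.integrand_eq_ite_symm, P.band_pt, P.cast_mu]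
  exact key

/-! ## §2 `vAB` on the kernel data -/

/-- **`vAB` is sound, straddler `p + q`.** -/
theorem Params.vAB_sh_valid (P : Params) (hP : P.admissible = true) {a b c d : ℤ} (hin : P.InRoot a b c d) (hab : a < b) (hcd : c < d)
    (far : Bool) (hg : (P.cell (P.mkX a) (P.mkX b) (P.mkY c) (P.mkY d)).guards = true) (hs1 : P.status (P.cell (P.mkX a) (P.mkX b) (P.mkY c) (P.mkY d)).e1Lo (P.cell (P.mkX a) (P.mkX b) (P.mkY c) (P.mkY d)).e1Hi = some far)
    (hsLo : 0 < P.sDnZ (P.cell (P.mkX a) (P.mkX b) (P.mkY c) (P.mkY d)).aLo') (hsUp : 0 < P.sDnZ (P.cell (P.mkX a) (P.mkX b) (P.mkY c) (P.mkY d)).aUp') (hαα : (P.cell (P.mkX a) (P.mkX b) (P.mkY c) (P.mkY d)).aLo' ≤ (P.cell (P.mkX a) (P.mkX b) (P.mkY c) (P.mkY d)).aUp') (hV : 0 < P.distLoZ (P.cell (P.mkX a) (P.mkX b) (P.mkY c) (P.mkY d)).e1Lo (P.cell (P.mkX a) (P.mkX b) (P.mkY c) (P.mkY d)).e1Hi)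
    {τx τy : ℕ} (hτx : 0 < τx) (hτy : 0 < τy) (hokx : sinLoOK (P.cell (P.mkX a) (P.mkX b) (P.mkY c) (P.mkY d)).aLo' (P.cell (P.mkX a) (P.mkX b) (P.mkY c) (P.mkY d)).aUp' τx = true) (hoky : sinLoOK (P.cell (P.mkX a) (P.mkX b) (P.mkY c) (P.mkY d)).bLo' (P.cell (P.mkX a) (P.mkX b) (P.mkY c) (P.mkY d)).bUp' τy = true) :
    P.CeilValid a b c d (cdivZ (2 ^ 30 * 10 ^ 8 *
      ((List.range MA).map fun m => P.bdryPieceUp (!far) (P.distLoZ (P.cell (P.mkX a) (P.mkX b) (P.mkY c) (P.mkY d)).e1Lo (P.cell (P.mkX a) (P.mkX b) (P.mkY c) (P.mkY d)).e1Hi) (linGridZ (P.cell (P.mkX a) (P.mkX b) (P.mkY c) (P.mkY d)).aLo' (P.cell (P.mkX a) (P.mkX b) (P.mkY c) (P.mkY d)).aUp' MA m) (linGridZ (P.cell (P.mkX a) (P.mkX b) (P.mkY c) (P.mkY d)).aLo' (P.cell (P.mkX a) (P.mkX b) (P.mkY c) (P.mkY d)).aUp' MA (m + 1)) (P.cell (P.mkX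 a) (P.mkX b) (P.mkY c) (P.mkY d)).bLo' (P.cell (P.mkX a) (P.mkX b) (P.mkY c) (P.mkY d)).bUp').sum)
      ((τx : ℤ) * (τy : ℤ) * D)) := by
  obtain ⟨htpD, hmuD, hU, -, -⟩ := P.admissible_facts hP
  obtain ⟨ha, -, -, hb, hc, -, -, hd⟩ := id hin
  have hMA : 0 < MA := by decide
  -- every breakpoint has a positive slope record
  have hSpos : ∀ m, m ≤ MA → 0 < P.sDnZ (linGridZ (P.cell (P.mkX a) (P.mkX b) (P.mkY c) (P.mkY d)).aLo' (P.cell (P.mkX a) (P.mkX b) (P.mkY c) (P.mkY d)).aUp' MA m) := by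
    intro m hm
    obtain ⟨h0, h1⟩ := linGridZ_mem hαα hMA hm
    exact lt_of_lt_of_le (lt_min hsLo hsUp) (P.sDnZ_between htpD h0 h1)
  have hSmin : ∀ m, m < MA → 0 < min (P.sDnZ (linGridZ (P.cell (P.mkX a) (P.mkX b) (P.mkY c) (P.mkY d)).aLo' (P.cell (P.mkX a) (P.mkX b) (P.mkY c) (P.mkY d)).aUp' MA m)) (P.sDnZ (linGridZ (P.cell (P.mkX a) (P.mkX b) (P.mkY c) (P.mkY d)).aLo' (P.cell (P.mkX a) (P.mkX b) (P.mkY c) (P.mkY d)).aUp' MA (m + 1))) :=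
    fun m hm => lt_min (hSpos m hm.le) (hSpos (m + 1) hm)
  refine P.hyperbolaAB_core hP hab hcd far (αLo := (P.cell (P.mkX a) (P.mkX b) (P.mkY c) (P.mkY d)).aLo') (αUp := (P.cell (P.mkX a) (P.mkX b) (P.mkY c) (P.mkY d)).aUp') (βLo := (P.cell (P.mkX a) (P.mkX b) (P.mkY c) (P.mkY d)).bLo') (βUp := (P.cell (P.mkX a) (P.mkX b) (P.mkY c) (P.mkY d)).bUp') (sx := (P.q1z : ℝ) / (P.U : ℝ)) (sy := (P.q2z : ℝ) / (P.U : ℝ))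
    (mpos := fun x => P.cresPos far ((((P.cell (P.mkX a) (P.mkX b) (P.mkY c) (P.mkY d)).bLo' : ℤ) : ℝ) / 2 ^ 40) ((((P.cell (P.mkX a) (P.mkX b) (P.mkY c) (P.mkY d)).bUp' : ℤ) : ℝ) / 2 ^ 40) (Real.cos (x + (P.q1z : ℝ) / (P.U : ℝ)))) hαα hV hτx hτy hSmin ?_ ?_ ?_ ?_
  · intro x hx y hy m hm hm0 hm1
    exact P.dom_sh_gen hP hin far hg hs1 (hSpos m (Nat.le_of_lt hm)) (hSpos (m + 1) hm) hV hx hy ⟨hm0, hm1⟩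
  · intro y hy
    obtain ⟨β1, β2⟩ := P.cell_cosy'_mem hP (a := a) (b := b) hc hd hy.1 hy.2
    exact ⟨⟨β1, β2⟩, le_abs_sin_of_sinLoOK hoky β1 β2⟩
  · intro x hx
    obtain ⟨α1, α2⟩ := P.cell_cosx'_mem hP (c := c) (d := d) ha hb hx.1 hx.2
    exact ⟨⟨α1, α2⟩, le_abs_sin_of_sinLoOK hokx α1 α2⟩
  · intro x hx m hm hm0 hm1
    exact (P.extent_le hP far (P.sPos_of_sDnZ_pos htpD (hSpos m (Nat.le_of_lt hm))) (P.sPos_of_sDnZ_pos htpD (hSpos (m + 1) hm)) hm0 hm1).2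

/-- **`vAB` is sound, straddler `p`.** -/
theorem Params.vAB_nsh_valid (P : Params) (hP : P.admissible = true) {a b c d : ℤ} (hin : P.InRoot a b c d) (hab : a < b) (hcd : c < d)
    (far : Bool) (hg : (P.cell (P.mkX a) (P.mkX b) (P.mkY c) (P.mkY d)).guards = true) (hs2 : P.status (P.cell (P.mkX a) (P.mkX b) (P.mkY c) (P.mkY d)).e2Lo (P.cell (P.mkX a) (P.mkX b) (P.mkY c) (P.mkY d)).e2Hi = some far)
    (hsLo : 0 < P.sDnZ (P.cell (P.mkX a) (P.mkX b) (P.mkY c) (P.mkY d)).aLo) (hsUp : 0 < P.sDnZ (P.cell (P.mkX a) (P.mkX b) (P.mkY c) (P.mkY d)).aUp) (hαα : (P.cell (P.mkX a) (P.mkX b) (P.mkY c) (P.mkY d)).aLo ≤ (P.cell (P.mkX a) (P.mkX b) (P.mkY c) (P.mkY d)).aUp) (hV : 0 < P.distLoZ (P.cell (P.mkX a) (P.mkX b) (P.mkY c) (P.mkY d)).e2Lo (P.cell (P.mkX a) (P.mkX b) (P.mkY c) (P.mkY d)).e2Hi)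
    {τx τy : ℕ} (hτx : 0 < τx) (hτy : 0 < τy) (hokx : sinLoOK (P.cell (P.mkX a) (P.mkX b) (P.mkY c) (P.mkY d)).aLo (P.cell (P.mkX a) (P.mkX b) (P.mkY c) (P.mkY d)).aUp τx = true) (hoky : sinLoOK (P.cell (P.mkX a) (P.mkX b) (P.mkY c) (P.mkY d)).bLo (P.cell (P.mkX a) (P.mkX b) (P.mkY c) (P.mkY d)).bUp τy = true) :
    P.CeilValid a b c d (cdivZ (2 ^ 30 * 10 ^ 8 *
      ((List.range MA).map fun m => P.bdryPieceUp (!far) (P.distLoZ (P.cell (P.mkX a) (P.mkX b) (P.mkY c) (P.mkY d)).e2Lo (P.cell (P.mkX a) (P.mkX b) (P.mkY c) (P.mkY d)).e2Hi) (linGridZ (P.cell (P.mkX a) (P.mkX b) (P.mkY c) (P.mkY d)).aLo (P.cell (P.mkX a) (P.mkX b) (P.mkY c) (P.mkY d)).aUp MA m) (linGridZ (P.cell (P.mkX a) (P.mkX b) (P.mkY c) (P.mkY d)).aLo (P.cell (P.mkX a) (P.mkX b) (P.mkY c) (P.mkY d)).aUp MA (m + 1)) (P.cell (P.mkX a) (P.mkX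 b) (P.mkY c) (P.mkY d)).bLo (P.cell (P.mkX a) (P.mkX b) (P.mkY c) (P.mkY d)).bUp).sum)
      ((τx : ℤ) * (τy : ℤ) * D)) := by
  obtain ⟨htpD, hmuD, hU, -, -⟩ := P.admissible_facts hP
  obtain ⟨ha, -, -, hb, hc, -, -, hd⟩ := id hin
  have hMA : 0 < MA := by decide
  -- every breakpoint has a positive slope record
  have hSpos : ∀ m, m ≤ MA → 0 < P.sDnZ (linGridZ (P.cell (P.mkX a) (P.mkX b) (P.mkY c) (P.mkY d)).aLo (P.cell (P.mkX a) (P.mkX b) (P.mkY c) (P.mkY d)).aUp MA m) := by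
    intro m hm
    obtain ⟨h0, h1⟩ := linGridZ_mem hαα hMA hm
    exact lt_of_lt_of_le (lt_min hsLo hsUp) (P.sDnZ_between htpD h0 h1)
  have hSmin : ∀ m, m < MA → 0 < min (P.sDnZ (linGridZ (P.cell (P.mkX a) (P.mkX b) (P.mkY c) (P.mkY d)).aLo (P.cell (P.mkX a) (P.mkX b) (P.mkY c) (P.mkY d)).aUp MA m)) (P.sDnZ (linGridZ (P.cell (P.mkX a) (P.mkX b) (P.mkY c) (P.mkY d)).aLo (P.cell (P.mkX a) (P.mkX b) (P.mkY c) (P.mkY d)).aUp MA (m + 1))) :=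
    fun m hm => lt_min (hSpos m hm.le) (hSpos (m + 1) hm)
  refine P.hyperbolaAB_core hP hab hcd far (αLo := (P.cell (P.mkX a) (P.mkX b) (P.mkY c) (P.mkY d)).aLo) (αUp := (P.cell (P.mkX a) (P.mkX b) (P.mkY c) (P.mkY d)).aUp) (βLo := (P.cell (P.mkX a) (P.mkX b) (P.mkY c) (P.mkY d)).bLo) (βUp := (P.cell (P.mkX a) (P.mkX b) (P.mkY c) (P.mkY d)).bUp) (sx := 0) (sy := 0)
    (mpos := fun x => P.cresPos far ((((P.cell (P.mkX a) (P.mkX b) (P.mkY c) (P.mkY d)).bLo : ℤ) : ℝ) / 2 ^ 40) ((((P.cell (P.mkX a) (P.mkX b) (P.mkY c) (P.mkY d)).bUp : ℤ) : ℝ) / 2 ^ 40) (Real.cos x)) hαα hV hτx hτy hSmin ?_ ?_ ?_ ?_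
  · intro x hx y hy m hm hm0 hm1
    have hm0' : ((linGridZ (P.cell (P.mkX a) (P.mkX b) (P.mkY c) (P.mkY d)).aLo (P.cell (P.mkX a) (P.mkX b) (P.mkY c) (P.mkY d)).aUp MA m : ℤ) : ℝ) / 2 ^ 40 ≤ Real.cos x := by simpa using hm0
    have hm1' : Real.cos x ≤ ((linGridZ (P.cell (P.mkX a) (P.mkX b) (P.mkY c) (P.mkY d)).aLo (P.cell (P.mkX a) (P.mkX b) (P.mkY c) (P.mkY d)).aUp MA (m + 1) : ℤ) : ℝ) / 2 ^ 40 := by simpa using hm1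
    exact P.dom_nsh_gen hP hin far hg hs2 (hSpos m (Nat.le_of_lt hm)) (hSpos (m + 1) hm) hV hx hy ⟨hm0', hm1'⟩
  · intro y hy
    obtain ⟨β1, β2⟩ := P.cell_cosy_mem hP (a := a) (b := b) hc hd hy.1 hy.2
    rw [add_zero]; exact ⟨⟨β1, β2⟩, le_abs_sin_of_sinLoOK hoky β1 β2⟩
  · intro x hx
    obtain ⟨α1, α2⟩ := P.cell_cosx_mem hP (c := c) (d := d) ha hb hx.1 hx.2
    rw [add_zero]; exact ⟨⟨α1, α2⟩, le_abs_sin_of_sinLoOK hokx α1 α2⟩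
  · intro x hx m hm hm0 hm1
    have hm0' : ((linGridZ (P.cell (P.mkX a) (P.mkX b) (P.mkY c) (P.mkY d)).aLo (P.cell (P.mkX a) (P.mkX b) (P.mkY c) (P.mkY d)).aUp MA m : ℤ) : ℝ) / 2 ^ 40 ≤ Real.cos x := by simpa using hm0
    have hm1' : Real.cos x ≤ ((linGridZ (P.cell (P.mkX a) (P.mkX b) (P.mkY c) (P.mkY d)).aLo (P.cell (P.mkX a) (P.mkX b) (P.mkY c) (P.mkY d)).aUp MA (m + 1) : ℤ) : ℝ) / 2 ^ 40 := by simpa using hm1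
    exact (P.extent_le hP far (P.sPos_of_sDnZ_pos htpD (hSpos m (Nat.le_of_lt hm))) (P.sPos_of_sDnZ_pos htpD (hSpos (m + 1) hm)) hm0' hm1').2

end Summit.HubbardSuperconductivity.HubbardSuperconductivity.Theorems.KlLindhardEnclosure

end
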